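import Literature.Geometry.Lorentzian.CoordHodgeStar
import Literature.Geometry.Lorentzian.CoordInnerLaplacian
import HarnessLib

/-!
# `Δ⋆ = ⋆Δ` and the Laplacian of the chiral pairing `⟨T, ⋆T⟩`

Rank-generic coordinate tensor calculus (`CoordTensorCalculus.lean`, `CoordHodgeStar.lean`,
`CoordInnerLaplacian.lean`): metric components `G` on an open set `V` of a `4`-dimensional space with
basis `b`, Riemannian on `V`; `⋆ = star0 G b` the Hodge star on the first pair of `4`-tensor fields,
`∇⋆ = ⋆∇` (`IsMetricOn.tcov_star0`, `tcov_star1`). Here: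

* `star0_apply_sum_mul` — pointwise linearity of `⋆` (constant coefficients);
* **`IsMetricOn.tlap_star0` — `Δ(⋆T) = ⋆(ΔT)`** at points of `V` (`Δ = tr ∇²` the rough
  Laplacian): `∇(⋆T) = ⋆₁(∇T)` on the open set `V`, hence `∇∇(⋆T) = ∇(⋆₁∇T) = ⋆₂(∇∇T)`, and the
  trace commutes with the slice-wise star (Besse 1987, 1.51, 13.7: `⋆` is parallel);
* **`IsMetricOn.lapAt_tinner_star0` — `Δ⟨T, ⋆T⟩ = ⟨ΔT, ⋆T⟩ + 2⟨∇T, ⋆₁∇T⟩ + ⟨T, ⋆ΔT⟩`**, the chiral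
  companion of `Δ|T|² = 2⟨ΔT,T⟩ + 2|∇T|²`: with `|W⁺|² = ⅛(|W|² + ⟨W,⋆W⟩)` these two give
  `½Δ|W⁺|² = ⟨ΔW⁺, W⁺⟩ + |∇W⁺|²`, the differential part of Derdziński's Weitzenböck formula
  (Gursky–LeBrun 1999, (1.3)).

Everything is proved; no definition is introduced.

## References

* A. L. Besse, *Einstein manifolds*, Springer 1987, 1.51, 13.7. [Besse1987]
* M. J. Gursky, C. LeBrun, Ann. Global Anal. Geom. 17 (1999) 315–328, §3, (1.3). [GurskyLebrun1999]
* P. Topping, *Lectures on the Ricci flow*, CUP 2006, §2.1. [Topping2006]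
-/

noncomputable section

open Set Filter Module Function
open scoped Topology ContDiff

namespace Literature.Geometry.Lorentzian

namespace MetricCoord

variable {E : Type*} [NormedAddCommGroup E] [NormedSpace ℝ E] [FiniteDimensional ℝ E]
  {G : E → E →L[ℝ] E →L[ℝ] ℝ} (b : Basis (Fin 4) ℝ E) {V : Set E} {x : E}

/-- **Pointwise linearity of `⋆` with constant coefficients**:
`⋆(Σ_{jk} c_{jk} R^{jk})_I(y) = Σ_{jk} c_{jk} (⋆R^{jk})_I(y)`. [folklore] -/
theorem star0_apply_sum_mul {κ : Type*} [Fintype κ] (c : κ → κ → ℝ) (R : κ → κ → E → (Fin 4 → Fin 4) → ℝ)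
    (y : E) (I : Fin 4 → Fin 4) :
    star0 G b (fun y' I' ↦ ∑ j, ∑ k, c j k * R j k y' I') y I = ∑ j, ∑ k, c j k * star0 G b (R j k) y I := by
  simp only [star0_apply, Finset.mul_sum]
  -- move the sums over `j, k` outside the four sums of `star0_apply`
  have h : ∀ (f : κ → κ → Fin 4 → Fin 4 → Fin 4 → Fin 4 → ℝ),
      ∑ a, ∑ a', ∑ p, ∑ q, ∑ j, ∑ k, f j k a a' p q = ∑ j, ∑ k, ∑ a, ∑ a', ∑ p, ∑ q, f j k a a' p q := by
    intro f
    calc ∑ a, ∑ a', ∑ p, ∑ q, ∑ j, ∑ k, f j k a a' p q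
        = ∑ a, ∑ a', ∑ p, ∑ j, ∑ q, ∑ k, f j k a a' p q :=
          Finset.sum_congr rfl fun _ _ ↦ Finset.sum_congr rfl fun _ _ ↦
            Finset.sum_congr rfl fun _ _ ↦ Finset.sum_comm
      _ = ∑ a, ∑ a', ∑ j, ∑ p, ∑ q, ∑ k, f j k a a' p q :=
          Finset.sum_congr rfl fun _ _ ↦ Finset.sum_congr rfl fun _ _ ↦ Finset.sum_comm
      _ = ∑ a, ∑ j, ∑ a', ∑ p, ∑ q, ∑ k, f j k a a' p q := Finset.sum_congr rfl fun _ _ ↦ Finset.sum_comm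
      _ = ∑ j, ∑ a, ∑ a', ∑ p, ∑ q, ∑ k, f j k a a' p q := Finset.sum_comm
      _ = ∑ j, ∑ a, ∑ a', ∑ p, ∑ k, ∑ q, f j k a a' p q :=
          Finset.sum_congr rfl fun _ _ ↦ Finset.sum_congr rfl fun _ _ ↦
            Finset.sum_congr rfl fun _ _ ↦ Finset.sum_congr rfl fun _ _ ↦ Finset.sum_comm
      _ = ∑ j, ∑ a, ∑ a', ∑ k, ∑ p, ∑ q, f j k a a' p q :=
          Finset.sum_congr rfl fun _ _ ↦ Finset.sum_congr rfl fun _ _ ↦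
            Finset.sum_congr rfl fun _ _ ↦ Finset.sum_comm
      _ = ∑ j, ∑ a, ∑ k, ∑ a', ∑ p, ∑ q, f j k a a' p q :=
          Finset.sum_congr rfl fun _ _ ↦ Finset.sum_congr rfl fun _ _ ↦ Finset.sum_comm
      _ = ∑ j, ∑ k, ∑ a, ∑ a', ∑ p, ∑ q, f j k a a' p q := Finset.sum_congr rfl fun _ _ ↦ Finset.sum_comm
  rw [← h]
  exact Finset.sum_congr rfl fun a _ ↦ Finset.sum_congr rfl fun a' _ ↦ Finset.sum_congr rfl fun p _ ↦
    Finset.sum_congr rfl fun q _ ↦ Finset.sum_congr rfl fun j _ ↦ Finset.sum_congr rfl fun k _ ↦ by ring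

variable [CompleteSpace E]

/-- **`Δ⋆ = ⋆Δ`**: `(Δ(⋆T))_I = (⋆(ΔT))_I` at points of `V` (`Δ = tr ∇²`), for Riemannian components —
`∇(⋆T) = ⋆₁(∇T)` on `V` (`tcov_star0`), `∇(⋆₁∇T) = ⋆₂(∇∇T)` (`tcov_star1`) and `⋆` commutes with the
trace (Besse 1987, 13.7: the Hodge star is parallel). [cite: Besse1987, 13.7] -/
theorem IsMetricOn.tlap_star0 (hG : IsMetricOn G V) (hx : x ∈ V)
    (hpos : ∀ y ∈ V, ∀ v : E, v ≠ 0 → 0 < G y v v) {T : E → (Fin 4 → Fin 4) → ℝ}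
    (hT : TSmoothOn T V) (I : Fin 4 → Fin 4) :
    tlap G b (star0 G b T) x I = star0 G b (tlap G b T) x I := by
  have hS : TSmoothOn (tcov G b T) V := hG.tsmoothOn_tcov hT
  -- `∇(⋆T) = ⋆₁(∇T)` as fields on `V`
  have hV : ∀ y ∈ V, ∀ J, tcov G b (star0 G b T) y J = star1 G b (tcov G b T) y J := by
    intro y hy J
    rw [← ocons_eta J]
    exact hG.tcov_star0 b hy hpos hT (J none) (J ∘ some)
  rw [tlap_apply]
  have h1 : ∀ j k, tcov G b (tcov G b (star0 G b T)) x (ocons j (ocons k I)) =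
      star0 G b (fun y I' ↦ tcov G b (tcov G b T) y (ocons j (ocons k I'))) x I := by
    intro j k
    rw [tcov_congr hG.isOpen hV hx, hG.tcov_star1 b hx hpos hS j k I, star2_apply_ocons_ocons]
  simp only [h1]
  rw [← star0_apply_sum_mul b (fun j k ↦ ginv G b x j k)
    (fun j k y I' ↦ tcov G b (tcov G b T) y (ocons j (ocons k I'))) x I]
  exact star0_congr_apply G b (fun I' ↦ by rw [tlap_apply]) I

/-- **`Δ⟨T, ⋆T⟩ = ⟨ΔT, ⋆T⟩ + 2⟨∇T, ⋆₁∇T⟩ + ⟨T, ⋆ΔT⟩`** at points of `V` (Riemannian components),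
the chiral companion of `Δ|T|² = 2⟨ΔT, T⟩ + 2|∇T|²`: the polarised Bochner identity
(`lapAt_tinner`) with `∇(⋆T) = ⋆₁(∇T)` and `Δ(⋆T) = ⋆(ΔT)`. For the curvature tensor of an
oriented `4`-manifold, `|W⁺|² = ⅛(|W|² + ⟨W, ⋆W⟩)` and the two identities give
`½Δ|W⁺|² = ⟨ΔW⁺, W⁺⟩ + |∇W⁺|²` (Gursky–LeBrun 1999, (1.3), differential part).
[cite: GurskyLebrun1999, §3, (1.3)] [cite: Besse1987, 13.7] -/
theorem IsMetricOn.lapAt_tinner_star0 (hG : IsMetricOn G V) (hx : x ∈ V)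
    (hpos : ∀ y ∈ V, ∀ v : E, v ≠ 0 → 0 < G y v v) {T : E → (Fin 4 → Fin 4) → ℝ}
    (hT : TSmoothOn T V) :
    lapAt G (tinner G b T (star0 G b T)) x =
      tinner G b (tlap G b T) (star0 G b T) x + 2 * tinner G b (tcov G b T) (star1 G b (tcov G b T)) x +
        tinner G b T (star0 G b (tlap G b T)) x := by
  have hsT := hG.tsmoothOn_star0 b hpos hT
  rw [hG.lapAt_tinner hT hsT hx]
  have h2 : tinner G b (tcov G b T) (tcov G b (star0 G b T)) x =
      tinner G b (tcov G b T) (star1 G b (tcov G b T)) x := by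
    refine tinner_congr_apply (fun _ ↦ rfl) fun J ↦ ?_
    rw [← ocons_eta J]
    exact hG.tcov_star0 b hx hpos hT (J none) (J ∘ some)
  have h3 : tinner G b T (tlap G b (star0 G b T)) x = tinner G b T (star0 G b (tlap G b T)) x :=
    tinner_congr_apply (fun _ ↦ rfl) fun I ↦ hG.tlap_star0 b hx hpos hT I
  rw [h2, h3]

end MetricCoord

end Literature.Geometry.Lorentzian

end
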